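import Mathlib

/-!
# SoloBlind E54 — Sturm saturation lifts from `p` to `p^k`

Solo programme `solo-Langlands-blind`, own line (O1b), s118 (tower theory §13.9, claim C434(ii): "Sturm's theorem mod y^k, by induction
on k").  Abstract form: let `φ : L → ℤ^ι` be additive (think: `L` = integral cusp forms, `φ` = the first `B` q-expansion coefficients,
`B` ≥ the Sturm bound) and suppose the MOD-`p` statement holds: if every coordinate of `φ x` is divisible by `p` then `x ∈ pL`.
Then the MOD-`p^k` statement holds for every `k`: if every coordinate of `φ x` is divisible by `p^k` then `x ∈ p^k L` (`lift_pow`).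
Consequence used by the depth engine: a form whose first `B` coefficients agree with the Eisenstein series mod `y^k` agrees with it
mod `y^k` in every coefficient, so the associated functional on the Hecke ring is correct mod `y^k` on ALL `T_n`.
-/

set_option linter.dupNamespace false

namespace Summit.Langlands.Langlands.Theorems.SoloBlindSturmLift

/-- STURM LIFT: the mod-`p` saturation property of an additive coordinate map implies the mod-`p^k` property for all `k`. -/
theorem lift_pow {L : Type*} [AddCommGroup L] {ι : Type*} (φ : L →+ (ι → ℤ)) (p : ℤ) (hp : p ≠ 0)
    (h1 : ∀ x : L, (∀ i, p ∣ φ x i) → ∃ y : L, x = p • y) :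
    ∀ (k : ℕ) (x : L), (∀ i, p ^ k ∣ φ x i) → ∃ y : L, x = p ^ k • y := by
  intro k
  induction k with
  | zero => intro x _; exact ⟨x, by simp⟩
  | succ k ih =>
    intro x hx
    have hx1 : ∀ i, p ∣ φ x i := fun i => (dvd_pow_self p (Nat.succ_ne_zero k)).trans (hx i)
    obtain ⟨y, rfl⟩ := h1 x hx1
    have hy : ∀ i, p ^ k ∣ φ y i := by
      intro i
      obtain ⟨c, hc⟩ := hx i
      rw [map_zsmul, Pi.smul_apply, smul_eq_mul] at hc
      have hc' : p * φ y i = p * (p ^ k * c) := by rw [← mul_assoc, ← pow_succ']; exact hc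
      exact ⟨c, mul_left_cancel₀ hp hc'⟩
    obtain ⟨z, rfl⟩ := ih y hy
    exact ⟨z, by rw [smul_smul, pow_succ']⟩

/-- The same with the conclusion phrased as coordinatewise divisibility being equivalent at every level once it holds at level one,
for TORSION-FREE `L` read through `φ`: if moreover `φ` is injective, the witness `y` is unique. -/
theorem lift_pow_unique {L : Type*} [AddCommGroup L] {ι : Type*} (φ : L →+ (ι → ℤ)) (hφ : Function.Injective φ)
    (p : ℤ) (hp : p ≠ 0) (k : ℕ) (x y y' : L) (hy : x = p ^ k • y) (hy' : x = p ^ k • y') : y = y' := by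
  apply hφ
  have h : p ^ k • φ y = p ^ k • φ y' := by rw [← map_zsmul, ← map_zsmul, ← hy, ← hy']
  funext i
  have hi := congr_fun h i
  simp only [Pi.smul_apply, smul_eq_mul] at hi
  exact mul_left_cancel₀ (pow_ne_zero k hp) hi

end Summit.Langlands.Langlands.Theorems.SoloBlindSturmLift
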